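import Mathlib
import Summits.Ventures.HodgeRepro2.T5WildConductor

/-!
# The conductor rule for conjugate-symplectic characters at a ramified place (T5SymplecticConductorRule)

[FM21-Thm-1.1] (route/T5-route-2.md l. 298; Biswas, Forum Math. 33 (2021), arXiv:1908.05353 p0003 ll. 45–50): «Let
`K/F` be a quadratic wildly ramified extension with ramification break `t`. Then `a(ω_{K/F}) = t + 1`, and a symplectic-type
character `χ` has conductor `m = 2t + 1` (`m` odd) or `m ≥ 2(t + 1)` (`m` even).» The first half is T5WildConductor
(`f(η_v) = i = t + 1`, `i = v_E(σ π − π)`); this file proves the second half from it, at EVERY ramified place (tame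
included, `t = 0`: odd conductor `= 1`, even conductor `≥ 2` — [FM21-Rem] p0007 ll. 38–39), for a character
`χ : L_w^× →* ℂˣ` that agrees with `η_v` on `F_v^×` (t6-p8's `Fsub` / `ηF` vocabulary), smooth or not.

THE ARGUMENT: `U_E^{(2k)} ⊆ U_F^{(k)} · U_E^{(2k+1)}` (the residue fields agree: the integral basis of `(u − 1)/ϖ^k`) and
`U_F^{(k)} ↦ U_E^{(2k)}` (row 169). If `a(χ) = 2k + 1` then `χ` is trivial on `U_E^{(2k+1)} ⊇ U_F^{(k+1)}`, so
`f ≤ k + 1`, and non-trivial on `U_E^{(2k)}`, hence on `U_F^{(k)}`, so `f > k`: `k = f − 1 = t`. If `a(χ) = 2k` then `χ`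
is trivial on `U_E^{(2k)} ⊇ U_F^{(k)}`, so `f ≤ k`, i.e. `a(χ) ≥ 2f = 2t + 2`.
-/

namespace Summit.Ventures.HodgeRepro2.T5SymplecticConductorRule

open IsDedekindDomain HeightOneSpectrum
open Summit.Ventures.HodgeRepro2.T5ConductorArithmetic Summit.Ventures.HodgeRepro2.T5NormCharConductor
open Summit.Ventures.HodgeRepro2.T5RamifiedIntegralBasis Summit.Ventures.HodgeRepro2.T5WildConductor
open Summit.Ventures.HodgeRepro2.T6.N5LocalInertCompletion Summit.Ventures.HodgeRepro2.T6.N5LocalRamCompletion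

variable {K : Type*} [Field K] [NumberField K] (v : HeightOneSpectrum (NumberField.RingOfIntegers K))
  {L : Type*} [Field L] [NumberField L] [Algebra K L] (w : HeightOneSpectrum (NumberField.RingOfIntegers L))
  [w.asIdeal.LiesOver v.asIdeal]
  [ContinuousSMul (v.adicCompletion K) (w.adicCompletion L)]
  [IsScalarTower K (v.adicCompletion K) (w.adicCompletion L)]

noncomputable section

/-! ### `U_E^{(2k)} ⊆ U_F^{(k)} · U_E^{(2k+1)}` -/

omit [IsScalarTower K (v.adicCompletion K) (w.adicCompletion L)] in
/-- Every `u ∈ U_E^{(2k)}` is `(alg y) · u'` with `y ∈ U_F^{(k)}` and `u' ∈ U_E^{(2k+1)}` (residue fields agree: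
`(u − 1)/ϖ^k = alg a + alg b π` with `a, b` integral, `y := 1 + ϖ^k a`). -/
theorem exists_mem_unitFiltration_mul_inv_mem (h2 : Module.finrank (v.adicCompletion K) (w.adicCompletion L) = 2)
    {ϖ : v.adicCompletionIntegers K} (hϖ : Irreducible ϖ) {π : w.adicCompletionIntegers L} (hπ : Irreducible π)
    (hram : ¬ Irreducible (algebraMap (v.adicCompletionIntegers K) (w.adicCompletionIntegers L) ϖ))
    {k : ℕ} {u : (w.adicCompletion L)ˣ} (hu : u ∈ Uπ w π (2 * k)) :
    ∃ y ∈ unitFiltration v ϖ k, u * (T5UnramifiedCharacter.baseUnits v w y)⁻¹ ∈ Uπ w π (2 * k + 1) := by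
  rw [T5RamifiedOddConductor.Uπ_eq_unitFiltration] at hu
  have hu1 : Valued.v (u : w.adicCompletion L) = 1 :=
    (mem_unitFiltration_zero_iff w π u).mp (unitFiltration_antitone w π (Nat.zero_le _) hu)
  have hu2 : Valued.v ((u : w.adicCompletion L) - 1) ≤ WithZero.exp (-((2 * k : ℕ) : ℤ)) :=
    val_sub_one_le_of_mem_unitFiltration w hπ hu
  set ϖk : v.adicCompletion K := (ϖ : v.adicCompletion K) ^ k with hϖk
  have hϖkv : Valued.v ϖk = WithZero.exp (-(k : ℤ)) := by
    rw [hϖk, map_pow, T5AdicCompletionNormGroup.val_uniformizer v hϖ, ← WithZero.exp_nsmul]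
    congr 1
    rw [nsmul_eq_mul]
    ring
  have hϖkalg : Valued.v (algebraMap (v.adicCompletion K) (w.adicCompletion L) ϖk) = WithZero.exp (-((2 * k : ℕ) : ℤ)) := by
    rw [T5RamifiedNormTransfer.val_algebraMap_eq_sq v w h2 hϖ hπ hram, hϖkv, ← WithZero.exp_nsmul]
    congr 1
    rw [nsmul_eq_mul]
    push_cast
    ring
  have hϖk0 : algebraMap (v.adicCompletion K) (w.adicCompletion L) ϖk ≠ 0 := by
    intro h
    rw [h, map_zero] at hϖkalg
    exact WithZero.exp_ne_zero hϖkalg.symm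
  have hq : Valued.v (((u : w.adicCompletion L) - 1) / algebraMap (v.adicCompletion K) (w.adicCompletion L) ϖk) ≤ 1 := by
    rw [map_div₀, hϖkalg]
    calc Valued.v ((u : w.adicCompletion L) - 1) / WithZero.exp (-((2 * k : ℕ) : ℤ))
        ≤ WithZero.exp (-((2 * k : ℕ) : ℤ)) / WithZero.exp (-((2 * k : ℕ) : ℤ)) := by
          gcongr
          exact zero_le
      _ = 1 := div_self WithZero.exp_ne_zero
  obtain ⟨a, b, ha, hb, hq'⟩ :=
    exists_eq_algebraMap_add_algebraMap_mul_uniformizer_of_val_le_one v w h2 hϖ hπ hram hq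
  rw [div_eq_iff hϖk0] at hq'
  -- `u − 1 = alg (ϖ^k a) + alg (ϖ^k b) π`
  set r : w.adicCompletion L :=
    algebraMap (v.adicCompletion K) (w.adicCompletion L) (ϖk * b) * (π : w.adicCompletion L) with hr
  have hrv : Valued.v r ≤ WithZero.exp (-((2 * k + 1 : ℕ) : ℤ)) := by
    rw [hr, map_mul, map_mul, map_mul, hϖkalg, T5AdicCompletionNormGroup.val_uniformizer w hπ]
    calc WithZero.exp (-((2 * k : ℕ) : ℤ)) * Valued.v (algebraMap (v.adicCompletion K) (w.adicCompletion L) b) *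
          WithZero.exp (-1)
        ≤ WithZero.exp (-((2 * k : ℕ) : ℤ)) * 1 * WithZero.exp (-1) := by
          gcongr
          exact (T5ContinuousValuationExtension.val_algebraMap_le_one_iff b).mpr hb
      _ = WithZero.exp (-((2 * k + 1 : ℕ) : ℤ)) := by
          rw [mul_one, ← WithZero.exp_add]
          congr 1
          push_cast
          ring
  set y : v.adicCompletion K := 1 + ϖk * a with hy
  have hualg : (u : w.adicCompletion L) = algebraMap (v.adicCompletion K) (w.adicCompletion L) y + r := by
    rw [hy, hr, map_add, map_one, map_mul, map_mul]
    have : (u : w.adicCompletion L) = 1 + ((u : w.adicCompletion L) - 1) := by ring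
    rw [this, hq']
    ring
  have hrlt : Valued.v r < Valued.v (u : w.adicCompletion L) := by
    rw [hu1]
    refine lt_of_le_of_lt hrv ?_
    rw [← WithZero.exp_zero]
    exact WithZero.exp_lt_exp.mpr (by omega)
  have hyalg : Valued.v (algebraMap (v.adicCompletion K) (w.adicCompletion L) y) = 1 := by
    have : algebraMap (v.adicCompletion K) (w.adicCompletion L) y = (u : w.adicCompletion L) + (-r) := by
      rw [hualg]
      ring
    rw [this, Valuation.map_add_eq_of_lt_left _ (by rw [Valuation.map_neg]; exact hrlt), hu1]
  have hyv : Valued.v y = 1 := (T5ContinuousValuationExtension.val_algebraMap_eq_one_iff y).mp hyalg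
  have hy0 : y ≠ 0 := by
    intro h
    rw [h, map_zero] at hyv
    exact zero_ne_one hyv
  set yu : (v.adicCompletion K)ˣ := Units.mk0 y hy0 with hyu
  have hyucoe : (yu : v.adicCompletion K) = y := rfl
  have hbase : ((T5UnramifiedCharacter.baseUnits v w yu : (w.adicCompletion L)ˣ) : w.adicCompletion L) =
      algebraMap (v.adicCompletion K) (w.adicCompletion L) y := rfl
  refine ⟨yu, ?_, ?_⟩
  · apply mem_unitFiltration_of_val_sub_one_le v hϖ yu
    · rw [hyucoe]
      exact hyv
    · rw [hyucoe, hy, add_sub_cancel_left, map_mul, hϖkv]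
      calc WithZero.exp (-(k : ℤ)) * Valued.v a ≤ WithZero.exp (-(k : ℤ)) * 1 := by gcongr
        _ = WithZero.exp (-(k : ℤ)) := mul_one _
  · rw [T5RamifiedOddConductor.Uπ_eq_unitFiltration]
    apply mem_unitFiltration_of_val_sub_one_le w hπ
    · rw [Units.val_mul, Units.val_inv_eq_inv_val, map_mul, map_inv₀, hu1, hbase, hyalg]
      simp
    · have hyne : algebraMap (v.adicCompletion K) (w.adicCompletion L) y ≠ 0 := (map_ne_zero _).mpr hy0
      have : ((u * (T5UnramifiedCharacter.baseUnits v w yu)⁻¹ : (w.adicCompletion L)ˣ) : w.adicCompletion L) - 1 =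
          r / algebraMap (v.adicCompletion K) (w.adicCompletion L) y := by
        rw [Units.val_mul, Units.val_inv_eq_inv_val, hbase, hualg, add_mul, mul_inv_cancel₀ hyne, div_eq_mul_inv]
        ring
      rw [this, map_div₀, hyalg, div_one]
      exact hrv

/-! ### Transport between `η_v` on `F_v^×` and `χ` on `L_w^×` -/

omit [ContinuousSMul (v.adicCompletion K) (w.adicCompletion L)]
  [IsScalarTower K (v.adicCompletion K) (w.adicCompletion L)] in
/-- If `χ` agrees with `η_v` on `F_v^×` and kills `alg y`, then `η_v(y) = 1`. -/
theorem normChar_eq_one_of_mem_ker (σ : (w.adicCompletion L) ≃ₐ[v.adicCompletion K] (w.adicCompletion L))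
    (hind : (T5AdicCompletionNormGroup.normGroup v w σ).index = 2) (χ : (w.adicCompletion L)ˣ →* ℂˣ)
    (hχ : ∀ f : Fsub v w, χ f = ηF v w σ hind f) (y : (v.adicCompletion K)ˣ)
    (hy : T5UnramifiedCharacter.baseUnits v w y ∈ χ.ker) : T5LocalNormCharacter.normChar v w σ hind y = 1 := by
  have h1 : χ (T5UnramifiedCharacter.baseUnits v w y) = 1 := MonoidHom.mem_ker.mp hy
  rw [hχ ⟨T5UnramifiedCharacter.baseUnits v w y, ⟨y, rfl⟩⟩, ηF_baseUnits] at h1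
  rcases Int.units_eq_one_or (T5LocalNormCharacter.normChar v w σ hind y) with h | h
  · exact h
  · exfalso
    rw [h] at h1
    have : ((Units.map (Int.castRingHom ℂ).toMonoidHom (-1 : ℤˣ) : ℂˣ) : ℂ) = 1 := by rw [h1]; rfl
    simp at this
    norm_num at this

omit [ContinuousSMul (v.adicCompletion K) (w.adicCompletion L)]
  [IsScalarTower K (v.adicCompletion K) (w.adicCompletion L)] in
/-- If `χ` kills `U_E^{(n)}` and `U_F^{(k)}` maps into `U_E^{(n)}`, then `f(η_v) ≤ k`. -/
theorem normCharConductor_le_of_le_ker (σ : (w.adicCompletion L) ≃ₐ[v.adicCompletion K] (w.adicCompletion L))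
    {ϖ : v.adicCompletionIntegers K} (hind : (T5AdicCompletionNormGroup.normGroup v w σ).index = 2)
    (χ : (w.adicCompletion L)ˣ →* ℂˣ) (hχ : ∀ f : Fsub v w, χ f = ηF v w σ hind f) {k : ℕ}
    (h : ∀ y ∈ unitFiltration v ϖ k, T5UnramifiedCharacter.baseUnits v w y ∈ χ.ker) :
    normCharConductor v w σ ϖ hind ≤ k := by
  apply T5NormCharConductor.normCharConductor_le_of_le_ker
  intro y hy
  rw [MonoidHom.mem_ker]
  exact normChar_eq_one_of_mem_ker v w σ hind χ hχ y (h y hy)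

/-! ### THE CONDUCTOR RULE -/

/-- ODD CONDUCTOR ⇒ `a(χ) = 2 (f − 1) + 1 = 2t + 1`: a character of `L_w^×` agreeing with `η_v` on `F_v^×` whose conductor
(for the filtration `U_E^{(n)}`) is odd has conductor exactly `2(f(η_v) − 1) + 1`. -/
theorem conductor_eq_of_odd (h2 : Module.finrank (v.adicCompletion K) (w.adicCompletion L) = 2)
    {ϖ : v.adicCompletionIntegers K} (hϖ : Irreducible ϖ) {π : w.adicCompletionIntegers L} (hπ : Irreducible π)
    (hram : ¬ Irreducible (algebraMap (v.adicCompletionIntegers K) (w.adicCompletionIntegers L) ϖ))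
    (σ : (w.adicCompletion L) ≃ₐ[v.adicCompletion K] (w.adicCompletion L))
    (hind : (T5AdicCompletionNormGroup.normGroup v w σ).index = 2)
    (χ : (w.adicCompletion L)ˣ →* ℂˣ) (hχ : ∀ f : Fsub v w, χ f = ηF v w σ hind f)
    (hsm : ∃ m, Uπ w π m ≤ χ.ker) (hodd : Odd (conductor (Uπ w π) χ)) :
    conductor (Uπ w π) χ = 2 * (normCharConductor v w σ ϖ hind - 1) + 1 := by
  obtain ⟨k, hk⟩ := hodd
  have hker : Uπ w π (2 * k + 1) ≤ χ.ker :=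
    le_ker_of_conductor_le (Uπ_antitone w π) hsm (le_of_eq hk)
  -- `f ≤ k + 1`: `U_F^{(k+1)} ↦ U_E^{(2k+2)} ⊆ U_E^{(2k+1)} ⊆ ker χ`
  have hle : normCharConductor v w σ ϖ hind ≤ k + 1 := by
    apply normCharConductor_le_of_le_ker v w σ hind χ hχ
    intro y hy
    apply hker
    apply Uπ_antitone w π (show 2 * k + 1 ≤ 2 * (k + 1) by omega)
    exact baseUnits_mem_map_higherUnits_two_mul v w h2 hϖ hπ hram hy
  -- `k < f`: `χ` is non-trivial on `U_E^{(2k)}`, hence on `U_F^{(k)}`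
  have hnot : ¬ Uπ w π (2 * k) ≤ χ.ker := by
    intro h
    have := conductor_le_of_le_ker h
    omega
  rw [SetLike.not_le_iff_exists] at hnot
  obtain ⟨u, hu, huk⟩ := hnot
  obtain ⟨y, hy, hyu⟩ := exists_mem_unitFiltration_mul_inv_mem v w h2 hϖ hπ hram hu
  have hyk : T5UnramifiedCharacter.baseUnits v w y ∉ χ.ker := by
    intro hyk
    apply huk
    have : u = u * (T5UnramifiedCharacter.baseUnits v w y)⁻¹ * T5UnramifiedCharacter.baseUnits v w y := by group
    rw [this]
    exact Subgroup.mul_mem _ (hker hyu) hyk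
  have hlt : k < normCharConductor v w σ ϖ hind := by
    by_contra hcon
    rw [not_lt] at hcon
    apply hyk
    rw [MonoidHom.mem_ker, hχ ⟨T5UnramifiedCharacter.baseUnits v w y, ⟨y, rfl⟩⟩, ηF_baseUnits]
    have h1 : T5LocalNormCharacter.normChar v w σ hind y = 1 := by
      have := unitFiltration_le_ker_of_normCharConductor_le v w σ hϖ hind hcon hy
      rwa [MonoidHom.mem_ker] at this
    rw [h1, map_one]
  omega

/-- EVEN CONDUCTOR ⇒ `a(χ) ≥ 2 f = 2t + 2`. -/
theorem le_conductor_of_even (h2 : Module.finrank (v.adicCompletion K) (w.adicCompletion L) = 2)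
    {ϖ : v.adicCompletionIntegers K} (hϖ : Irreducible ϖ) {π : w.adicCompletionIntegers L} (hπ : Irreducible π)
    (hram : ¬ Irreducible (algebraMap (v.adicCompletionIntegers K) (w.adicCompletionIntegers L) ϖ))
    (σ : (w.adicCompletion L) ≃ₐ[v.adicCompletion K] (w.adicCompletion L))
    (hind : (T5AdicCompletionNormGroup.normGroup v w σ).index = 2)
    (χ : (w.adicCompletion L)ˣ →* ℂˣ) (hχ : ∀ f : Fsub v w, χ f = ηF v w σ hind f)
    (hsm : ∃ m, Uπ w π m ≤ χ.ker) (heven : Even (conductor (Uπ w π) χ)) :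
    2 * normCharConductor v w σ ϖ hind ≤ conductor (Uπ w π) χ := by
  obtain ⟨k, hk⟩ := heven
  have hker : Uπ w π (2 * k) ≤ χ.ker :=
    le_ker_of_conductor_le (Uπ_antitone w π) hsm (le_of_eq (by omega))
  have hle : normCharConductor v w σ ϖ hind ≤ k := by
    apply normCharConductor_le_of_le_ker v w σ hind χ hχ
    intro y hy
    exact hker (baseUnits_mem_map_higherUnits_two_mul v w h2 hϖ hπ hram hy)
  omega

/-- [FM21-Thm-1.1], SECOND HALF, AS PRINTED (with `t = i − 1`, `i = v_E(σ π − π)` the break): a character of `L_w^×`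
agreeing with `η_v` on `F_v^×` (conjugate-symplectic) of conductor `m` (smooth) has `m = 2t + 1` if `m` is odd and
`m ≥ 2(t + 1)` if `m` is even — at every ramified place (tame: `t = 0`). -/
theorem conductor_rule (h2 : Module.finrank (v.adicCompletion K) (w.adicCompletion L) = 2)
    {ϖ : v.adicCompletionIntegers K} (hϖ : Irreducible ϖ) {π : w.adicCompletionIntegers L} (hπ : Irreducible π)
    (hram : ¬ Irreducible (algebraMap (v.adicCompletionIntegers K) (w.adicCompletionIntegers L) ϖ))
    (σ : (w.adicCompletion L) ≃ₐ[v.adicCompletion K] (w.adicCompletion L)) (hσ : σ ≠ 1)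
    {i : ℕ} (hi1 : 1 ≤ i) (hi : Valued.v (σ (π : w.adicCompletion L) - π) = WithZero.exp (-(i : ℤ)))
    (hind : (T5AdicCompletionNormGroup.normGroup v w σ).index = 2)
    (χ : (w.adicCompletion L)ˣ →* ℂˣ) (hχ : ∀ f : Fsub v w, χ f = ηF v w σ hind f)
    (hsm : ∃ m, Uπ w π m ≤ χ.ker) :
    (Odd (conductor (Uπ w π) χ) → conductor (Uπ w π) χ = 2 * (i - 1) + 1) ∧
      (Even (conductor (Uπ w π) χ) → 2 * (i - 1) + 2 ≤ conductor (Uπ w π) χ) := by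
  have hf := normCharConductor_eq_break v w h2 hϖ hπ hram σ hσ hi1 hi hind
  refine ⟨fun hodd => ?_, fun heven => ?_⟩
  · rw [conductor_eq_of_odd v w h2 hϖ hπ hram σ hind χ hχ hsm hodd, hf]
  · have := le_conductor_of_even v w h2 hϖ hπ hram σ hind χ hχ hsm heven
    rw [hf] at this
    omega

end

end Summit.Ventures.HodgeRepro2.T5SymplecticConductorRule
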